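import Summits.QuantumFields.GaugeBoot.PlanarCertificateResolvedSoundness
import Summits.QuantumFields.GaugeBoot.PlanarBootstrapLargeNRateWords
import HarnessLib

/-!
# Orientation-resolved planar certificates on the torus `(ℤ/L)^d` — the cell's objects — and their `1/N²` law at strong coupling (gauge-boot, large-`N` supplement 17)

HONEST FRAMING (cell `pub-gaugeboot`, page 1 of every file): the venture produces certified bounds
on lattice expectations at stated coupling, gauge group, dimension and torus size; NOT a mass gap,
NOT a continuum limit, NOT a string tension; NOT large `N` unless marked CONDITIONAL; NOT
Yang–Mills-summit-bearing (barriers `FixedCouplingUltralocality`, `PerturbativeInvisibility`).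
The strong-coupling rate is CONDITIONAL on the tree's named fact `shenZhuZhu_largeN_variance` (SZZ
CMP 400 (2023) Cor. 1.5 (1.12)); this file certifies no number and no planar certificate of the cell
exists in the tree.

## Content (sequel of `PlanarCertificateResolvedSoundness`)

* ★★★ `PlanarCertificate.obj_loopWT_le_uN_resolved` — **an orientation-resolved planar certificate at
  `βt = β/N` is EXACTLY sound for the `U(N)` torus Wilson state at every `(N, β, L)`** (rows closed and
  small for the torus, Gram words and relaxation loops closed, identification rows valid on the data):
  `obj(⟨W⟩_{N,β,L}) ≤ bound` — a certified bound on the cell's `U(N)` objects with no large-`N` header.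
* ★★ `abs_planarRow_loopDataT_suN_le` — the `SU(N)` planar row on the torus is bounded by
  `length(w)/N² + |β/N| Σ_{ν,ε} |Γ(w, P̃_{ν,ε})|` (supplement 10 had this inline).
* ★★★ `PlanarCertificate.obj_loopWT_le_suN_resolved` — `SU(N)` torus state at `(N, β, L)`:
  `obj ≤ bound + Σ_r |y_r| ε_r`, row defects only.
* ★★ `PlanarCertificate.obj_le_bound_add_div_sq_of_szz_resolved` — back on `ℤ^d`, GIVEN SZZ (1.12),
  `d ≥ 2`, `|βt| < 1/(16(d−1))`: for every thermodynamic limit point `μ_N` of the `SU(N)` torus states at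
  tree coupling `N·βt`, `obj(W_{μ_N}) ≤ bound + K_rows/N²` with `K_rows = szzRowRateConst` built from the
  marked words alone — the relaxation loops contribute nothing, the plaquette words need no data
  (supplement 19).

[folklore] conic bookkeeping on top of the tree's torus loop equations and SZZ; Kazakov–Zheng
arXiv:2203.11360 §3.
-/

noncomputable section

open MeasureTheory
open scoped BigOperators
open Literature.Probability.LatticeModels (Site zdGraph)
open Literature.MathematicalPhysics.QuantumLattice
open Literature.MathematicalPhysics.QuantumFieldTheory (szzThresholdSU shenZhuZhu_largeN_variance IsNonBacktrackingLoop
  GaugeConfig wilsonMeasure isProbabilityMeasure_wilsonMeasure)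

namespace Summit.QuantumFields.GaugeBoot

variable {d N : ℕ}

namespace PlanarCertificate

variable (P : PlanarCertificate d)

/-! ## The `1/N²` law for resolved certificates (strong coupling, given SZZ) -/

/-- **The row part of the `1/N²` constant** (certificate data, walk lengths of the marked words, `c₀`;
plaquette words cost `8/c₀` each, supplement 19); no relaxation-loop data. [folklore] -/
def szzRowRateConst (x : Site d) (γR : (r : Fin P.nR) → (zdGraph d).Walk x x) : ℝ :=
  ∑ r, |P.rowMult r| * (((P.rowWord r).length : ℝ) + |P.βt| * ∑ _ν ∈ Finset.univ.erase (P.rowAxis r), ∑ _ε : Bool,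
    (2 * (((γR r).length : ℝ) * (((γR r).length : ℝ) - 3)) + 8) / szzPlanarSlope d P.βt)

/-- ★★ **THE `1/N²` LAW FOR RESOLVED CERTIFICATES (given SZZ (1.12)).**  `d ≥ 2`, `|βt| < 1/(16(d−1))`;
`P` resolved-valid at `βt`; its marked words `w_r` realised by non-backtracking closed walks at `x`
(rows, Gram words, relaxation loops closed at `x`); `μ_N` (`N ≥ 1`) any thermodynamic limit point of
the `SU(N)` torus Wilson states at tree coupling `N·βt` satisfying the identification rows.  Then
`obj(W_{μ_N}) ≤ bound + K_rows/N²`, `K_rows = szzRowRateConst` — the relaxation loops contribute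
NOTHING and the plaquette words need no data. [cite: ShenZhuZhuCMP2023, Corollary 1.5] -/
theorem obj_le_bound_add_div_sq_of_szz_resolved (hP : P.IsValidResolved) (hfact : ∀ N, shenZhuZhu_largeN_variance d N)
    (hd : 2 ≤ d) (hβ : |P.βt| < szzThresholdSU d) (hN : 1 ≤ N)
    {μ : Measure (LGConfig d (Matrix.specialUnitaryGroup (Fin N) ℂ))}
    (hμ : μ ∈ infiniteVolumeLimitPoints (d := d) (fundamentalRep (Fin N)) ((N : ℝ) * P.βt)) (x : Site d)
    (hrow : ∀ r, Word.endpointZd x (P.rowWord r) = x) (hgram : ∀ j i, Word.endpointZd x (P.gramWord j i) = x)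
    (hS : ∀ A, Word.endpointZd x (P.shorLoop A) = x)
    (hlin : ∀ e, P.lin e (loopW (fundamentalRep (Fin N)) μ x) (loopQ (fundamentalRep (Fin N)) μ x) = 0)
    (γR : (r : Fin P.nR) → (zdGraph d).Walk x x) (hγR : ∀ r, IsNonBacktrackingLoop (γR r))
    (hholR : ∀ r (U : LGConfig d (Matrix.specialUnitaryGroup (Fin N) ℂ)), walkHolonomy U (γR r) = wordHolonomyZd U x (P.rowWord r)) :
    P.obj (loopW (fundamentalRep (Fin N)) μ x) ≤ P.bound + P.szzRowRateConst x γR / (N : ℝ) ^ 2 := by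
  haveI : SecondCountableTopology (Matrix (Fin N) (Fin N) ℂ) :=
    inferInstanceAs (SecondCountableTopology (Fin N → Fin N → ℂ))
  haveI : SecondCountableTopology (Matrix.specialUnitaryGroup (Fin N) ℂ) :=
    Topology.IsEmbedding.subtypeVal.secondCountableTopology
  have hβ' : (N : ℝ) * P.βt / N = P.βt := natCast_mul_div_natCast hN P.βt
  have h := P.obj_loopW_le_suN_of_mem_infiniteVolumeLimitPoints_resolved hP hβ' hμ x hrow hgram hS hlin
  refine h.trans ?_
  rw [szzRowRateConst, Finset.sum_div]
  gcongr with r _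
  rw [mul_div_assoc]
  gcongr
  exact P.rowDefectSuN_le_of_szz' hfact hd hβ hN hμ x γR hγR hholR r

/-! ## The torus `(ℤ/L)^d`: the cell's objects -/

section Torus

variable {L : ℕ}

/-- The resolved relaxation terms of a torus state's data are `≥ 0` (relaxation loops closed at `x`). [folklore] -/
theorem shorTermResolved_loopDataT_nonneg {G : Type*} [Group G] [TopologicalSpace G] [IsTopologicalGroup G]
    [CompactSpace G] [MeasurableSpace G] [BorelSpace G] (ρ : G →* Matrix (Fin N) (Fin N) ℂ) (hρ : Continuous ρ)
    (μ : Measure (GaugeConfig d L G)) [IsProbabilityMeasure μ] (x : Literature.MathematicalPhysics.QuantumFieldTheory.Site d L)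
    (hS : ∀ A, Word.endpoint x (P.shorLoop A) = x) (s : Fin P.nS) :
    0 ≤ P.shorTermResolved s (loopWT ρ μ x) (loopQT ρ μ x) :=
  shorPairing_loopDataT_resolved_nonneg ρ hρ μ x P.shorLoop hS _ _

variable [NeZero L]

/-- ★★★ **AN ORIENTATION-RESOLVED PLANAR CERTIFICATE IS EXACTLY SOUND FOR THE `U(N)` TORUS WILSON STATE
AT EVERY `(N, β, L)`** with `β/N = βt`: rows closed and small for the torus, Gram words and relaxation
loops closed, identification rows valid on the data ⇒ `obj(⟨W⟩_{N,β,L}) ≤ bound`.  A certified bound on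
the cell's `U(N)` objects with no large-`N` header. [folklore] -/
theorem obj_loopWT_le_uN_resolved (hP : P.IsValidResolved) {β : ℝ} (hβ : β / N = P.βt)
    (x : Literature.MathematicalPhysics.QuantumFieldTheory.Site d L)
    (hrow : ∀ r, Word.endpoint x (P.rowWord r) = x) (hsm : ∀ r, (P.rowWord r).Small L)
    (hgram : ∀ j i, Word.endpoint x (P.gramWord j i) = x) (hS : ∀ A, Word.endpoint x (P.shorLoop A) = x)
    (hlin : ∀ e, P.lin e (loopWT (unitaryFundamentalRep (Fin N) ℂ) (wilsonMeasure (d := d) (L := L) (unitaryFundamentalRep (Fin N) ℂ) β) x)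
      (loopQT (unitaryFundamentalRep (Fin N) ℂ) (wilsonMeasure (d := d) (L := L) (unitaryFundamentalRep (Fin N) ℂ) β) x) = 0) :
    P.obj (loopWT (unitaryFundamentalRep (Fin N) ℂ) (wilsonMeasure (d := d) (L := L) (unitaryFundamentalRep (Fin N) ℂ) β) x) ≤
      P.bound := by
  haveI := isProbabilityMeasure_wilsonMeasure (d := d) (L := L) (G := Matrix.unitaryGroup (Fin N) ℂ)
    (unitaryFundamentalRep (Fin N) ℂ) (continuous_unitaryFundamentalRep (Fin N) ℂ) β
  have h := P.obj_le_of_defects_resolved hP _ _ (fun _ => 0) (fun _ => 0)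
    (fun r => by rw [← hβ, planarRow_loopDataT_uN β x (P.rowAxis r) (P.rowWord r) (hrow r) (hsm r), abs_zero])
    (fun j => gramPairing_loopWT_nonneg _ (continuous_unitaryFundamentalRep (Fin N) ℂ) β x _ (hgram j) _)
    (P.shorTermResolved_loopDataT_nonneg _ (continuous_unitaryFundamentalRep (Fin N) ℂ) _ x hS)
    (fun e => by rw [hlin e, abs_zero])
  simpa using h

/-- ★★ **The `SU(N)` planar row on the torus, bounded**: for a closed word small for the torus,
`|planarRow (β/N) a w W Q| ≤ length(w)/N² + |β/N| Σ_{ν ≠ a} Σ_ε |Γ(w, P̃_{ν,ε})|` on the data of the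
`SU(N)` torus Wilson state at `(N, β, L)`. [folklore] -/
theorem abs_planarRow_loopDataT_suN_le (β : ℝ) (x : Literature.MathematicalPhysics.QuantumFieldTheory.Site d L) (a : Fin d)
    (w : Word d) (hw : Word.endpoint x w = x) (hsm : w.Small L) :
    |planarRow (β / N) a w (loopWT (fundamentalRep (Fin N)) (wilsonMeasure (d := d) (L := L) (fundamentalRep (Fin N)) β) x)
        (loopQT (fundamentalRep (Fin N)) (wilsonMeasure (d := d) (L := L) (fundamentalRep (Fin N)) β) x)| ≤
      (w.length : ℝ) / (N : ℝ) ^ 2 + |β / N| * ∑ ν ∈ Finset.univ.erase a, ∑ ε : Bool,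
        |loopImCovT (fundamentalRep (Fin N)) (wilsonMeasure (d := d) (L := L) (fundamentalRep (Fin N)) β) x w (plaqWord a ν ε)| := by
  haveI := isProbabilityMeasure_wilsonMeasure (d := d) (L := L) (G := Matrix.specialUnitaryGroup (Fin N) ℂ)
    (fundamentalRep (Fin N)) (continuous_fundamentalRep (Fin N)) β
  rw [planarRow_loopDataT_suN β x a w hw hsm]
  set μ := wilsonMeasure (d := d) (L := L) (fundamentalRep (Fin N)) β
  have hW : |loopWT (fundamentalRep (Fin N)) μ x w| ≤ 1 := by
    rw [loopWT_eq_integral_wordLoop _ (continuous_fundamentalRep (Fin N))]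
    exact abs_wilsonExpectation_wordLoop_le_one _ (continuous_fundamentalRep (Fin N)) β x _
  have hcf : (((Finset.range w.length).filter (w.fwdOccZ a)).card : ℝ) ≤ w.length := by
    exact_mod_cast (Finset.card_filter_le _ _).trans (Finset.card_range _).le
  have hcb : (((Finset.range w.length).filter (w.bwdOccZ a)).card : ℝ) ≤ w.length := by
    exact_mod_cast (Finset.card_filter_le _ _).trans (Finset.card_range _).le
  have hdiff : |(((Finset.range w.length).filter (w.fwdOccZ a)).card : ℝ) -
      ((Finset.range w.length).filter (w.bwdOccZ a)).card| ≤ w.length := by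
    rw [abs_sub_le_iff]
    constructor <;> linarith [Nat.cast_nonneg (α := ℝ) ((Finset.range w.length).filter (w.fwdOccZ a)).card,
      Nat.cast_nonneg (α := ℝ) ((Finset.range w.length).filter (w.bwdOccZ a)).card]
  have h1 : |((((Finset.range w.length).filter (w.fwdOccZ a)).card : ℝ) -
      ((Finset.range w.length).filter (w.bwdOccZ a)).card) / (N : ℝ) ^ 2 * loopWT (fundamentalRep (Fin N)) μ x w| ≤
        (w.length : ℝ) / (N : ℝ) ^ 2 := by
    rw [abs_mul, abs_div, abs_of_nonneg (by positivity : (0 : ℝ) ≤ (N : ℝ) ^ 2)]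
    rcases Nat.eq_zero_or_pos N with hN | hN
    · subst hN; simp
    · calc _ ≤ (w.length : ℝ) / (N : ℝ) ^ 2 * 1 := by gcongr
        _ = _ := mul_one _
  have h2 : |β / N * ∑ ν ∈ Finset.univ.erase a, ∑ ε : Bool, loopImCovT (fundamentalRep (Fin N)) μ x w (plaqWord a ν ε)| ≤
      |β / N| * ∑ ν ∈ Finset.univ.erase a, ∑ ε : Bool, |loopImCovT (fundamentalRep (Fin N)) μ x w (plaqWord a ν ε)| := by
    rw [abs_mul]
    gcongr
    exact (Finset.abs_sum_le_sum_abs _ _).trans (Finset.sum_le_sum fun ν _ => Finset.abs_sum_le_sum_abs _ _)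
  exact (abs_sub _ _).trans (add_le_add h1 h2)

/-- ★★★ **AN ORIENTATION-RESOLVED PLANAR CERTIFICATE BOUNDS THE `SU(N)` TORUS WILSON STATE AT
`(N, β, L)` UP TO THE ROW DEFECTS ONLY**: `obj(⟨W⟩_{N,β,L}) ≤ bound + Σ_r |y_r| (length(w_r)/N² +
|βt| Σ_{ν,ε} |Γ(w_r, P̃_{ν,ε})|)`. [folklore] -/
theorem obj_loopWT_le_suN_resolved (hP : P.IsValidResolved) {β : ℝ} (hβ : β / N = P.βt)
    (x : Literature.MathematicalPhysics.QuantumFieldTheory.Site d L)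
    (hrow : ∀ r, Word.endpoint x (P.rowWord r) = x) (hsm : ∀ r, (P.rowWord r).Small L)
    (hgram : ∀ j i, Word.endpoint x (P.gramWord j i) = x) (hS : ∀ A, Word.endpoint x (P.shorLoop A) = x)
    (hlin : ∀ e, P.lin e (loopWT (fundamentalRep (Fin N)) (wilsonMeasure (d := d) (L := L) (fundamentalRep (Fin N)) β) x)
      (loopQT (fundamentalRep (Fin N)) (wilsonMeasure (d := d) (L := L) (fundamentalRep (Fin N)) β) x) = 0) :
    P.obj (loopWT (fundamentalRep (Fin N)) (wilsonMeasure (d := d) (L := L) (fundamentalRep (Fin N)) β) x) ≤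
      P.bound + ∑ r, |P.rowMult r| * P.rowDefectSuNT (wilsonMeasure (d := d) (L := L) (fundamentalRep (Fin N)) β) x r := by
  haveI := isProbabilityMeasure_wilsonMeasure (d := d) (L := L) (G := Matrix.specialUnitaryGroup (Fin N) ℂ)
    (fundamentalRep (Fin N)) (continuous_fundamentalRep (Fin N)) β
  have h := P.obj_le_of_defects_resolved hP _ _
    (P.rowDefectSuNT (wilsonMeasure (d := d) (L := L) (fundamentalRep (Fin N)) β) x) (fun _ => 0)
    (fun r => by
      have h := abs_planarRow_loopDataT_suN_le (N := N) β x (P.rowAxis r) (P.rowWord r) (hrow r) (hsm r)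
      rw [hβ] at h
      exact h)
    (fun j => gramPairing_loopWT_nonneg _ (continuous_fundamentalRep (Fin N)) β x _ (hgram j) _)
    (P.shorTermResolved_loopDataT_nonneg _ (continuous_fundamentalRep (Fin N)) _ x hS)
    (fun e => by rw [hlin e, abs_zero])
  simpa using h

end Torus

end PlanarCertificate

end Summit.QuantumFields.GaugeBoot

end
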